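import Summits.QuantumFields.BalabanUV.T4Continuum.Support.RegionGaugeProjection

/-!
# T⁴ programme, spine node NE2 (U1a), sub-row Δ1 «NE2⁰-Dirichlet» — BAŁABAN's GAUGE-FIXED REGION OPERATOR `Δ_a = Δ + DRD* + Q*aQ`
# ([B9] (3.26)) FOR ABSTRACT DATA: the exact gauge decomposition along the projection `R` of (3.25), and the REDUCTION
# «`Δ_a` is coercive ⟺ the gauge-INVARIANT form `‖CA‖² + a‖QA‖²` is coercive on Bałaban's slice `{R·DᴴA = 0}`», constants explicit

NE2 formalisation swarm `b2b-balaban-t4-ne2-formalise-*`, leaf 07 (gen 5), supplier item «Δ1-COERC» under the owner's sub-row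
`T4-U1a.S-NE2-D1-DIRICHLET°` (owner ruling R21 (e), located item O12-c (iii): «coercivity of `∂*∂ + ∂R_{Ω₀}∂* + aQ*Q` on `Ω₀` uniformly
in `η` and `Ω₀` — a region Hodge-decomposition argument NOT in the tree», journal 2026-08-20 l.14713).

WHAT IS PRINTED ([Balaban1985BackgroundPropagators] pp. 394–395, renders read as images by the owner, quoted in
`Support/RegionGaugeProjection`): «R = R(U) is an orthogonal projection in the Hilbert space L²(Ω₀, g) onto the subspace R = Δ^η_U N(Q′),
N(Q′) = {λ : Q′λ = 0}» (3.21); «Rf = (I − G′Q′*(Q′G′²Q′*)⁻¹Q′G′)f, where G′ = G′(U) = (Δ′_a)⁻¹» (3.25); «Assuming some regularity of the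
configuration U it can be easily shown that the operator Δ′_a is positive. This implies positivity of the operators G′, Q′G′²Q′*, hence
the existence of the operator R» (p. 395); «Δ_a(U) = Δ^η(U) + D^η_U R(U) D^{η*}_U + Q*(U)aQ(U), or simply Δ_a = Δ + DRD* + Q*aQ. It coincides
with Δ_a in (2.19) if U = 1» (3.26); «G(U) = G = (Δ_a↾Ω₀)⁻¹» (3.27).  [Balaban1984PropagatorsI] (1.69) p. 29 prints the `U = 1` form
«⟨A, Δ_a A⟩ = ⟨A, ∂*∂A⟩ + ⟨A, ∂R∂*A⟩ + a⟨A, Q*QA⟩».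

WHAT THIS FILE DOES (generic finite-dimensional algebra; every carrier abstract).  Data: a «curl» `C : V → W`, a «gradient» `D : S → V`,
a scalar operator `Δ′` on `S` with two-sided inverse `G′`, a scalar averaging `Q′ : S → U`, a vector averaging `Q : V → U₁`, a unit-lattice
gradient `D₁ : U → U₁`, a coupling `a`.  Structural hypotheses (the `U = 1` lattice identities, bundled as the hypothesis STRUCTURE
`SliceData` on data — no `def … : Prop` fact): `C·D = 0` (curl of a gradient), `Q·D = D₁·Q′` ([Balaban1984PropagatorsI] (1.55)/(1.20)
«Q∂ = ∂₁Q′», tree: `VectorPropagatorDict.QvOp_mul_GradOp` on the torus), `Δ′λ = DᴴDλ` for `Q′λ = 0` (on `N(Q′)` the averaged scalar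
operator `Δ′_a = DᴴD + Q′*aQ′` IS the Laplacian), `G′` Hermitian with `G′Δ′ = Δ′G′ = 1`, `Q′G′²Q′ᴴ` invertible (owner's
`RegionGaugeProjection.isUnit_det_gramK`).  The GAUGE-FIXED OPERATOR is `gaugeFixed = CᴴC + D·gaugeR(G′,Q′)·Dᴴ + a·QᴴQ` — (3.26)'s
three terms with the owner's `gaugeR` for `R`.

 * §1 `gaugeFixed`, its Hermitian symmetry and its quadratic form `‖CA‖² + ‖R DᴴA‖² + a‖QA‖²` (`form_gaugeFixed`).
 * §2 THE EXACT GAUGE DECOMPOSITION along `R`: `λ_A := G′·R·DᴴA` («gauge part», `gaugePart`) lies in `N(Q′)` and `A′ := A − Dλ_A` («slice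
   part», `slicePart`) lies ON BAŁABAN's SLICE `R·DᴴA′ = 0`; `CA′ = CA`, `QA′ = QA`, `Δ′λ_A = R·DᴴA`; hence
   **`form_gaugeFixed_decomp`**: `⟨A, Δ_a A⟩ = ‖CA′‖² + ‖Δ′λ_A‖² + a‖QA′‖²`, and the gauge part is paid by the middle term:
   **`nsq_D_gaugePart_le`** `‖Dλ_A‖² ≤ ‖G′‖·‖Δ′λ_A‖²`.
 * §3 THE REDUCTION.  `SliceCoercive … c` := «`c‖A′‖² ≤ ‖CA′‖² + a‖QA′‖²` for every `A′` with `R·DᴴA′ = 0`» (a parametric shape predicate,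
   like `SubtypeCompression.Coercive`).  **`coercive_gaugeFixed_of_slice`**: slice coercivity `c` and `‖G′‖ ≤ g` ⟹ `Δ_a` coercive with
   `γ = min(c/2, 1/(2g))`, hence invertible with **`‖Δ_a⁻¹‖ ≤ γ⁻¹`** («G exists», (3.27), with a constant); conversely
   **`sliceCoercive_of_coercive`**: `Δ_a ≥ γ` ⟹ slice coercivity `γ`.  So for the [B9]-faithful region operator the analytic content of
   O12-c (iii) is EXACTLY one inequality — coercivity of the gauge-INVARIANT form (Wilson Hessian + block-spin mass) on the slice — the
   gauge half being discharged by the region scalar bound `‖G′(Ω₀)‖ ≤ γ′⁻¹` (road P2's `DirichletBoxCompression.opNorm_inv_DOm_le`).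
 * §4 POSITIVITY (the qualitative p. 395 sentence for the VECTOR operator): if «`CA = 0 ∧ QA = 0 ⟹ A = Dλ` with `Q′λ = 0`» (flat with zero
   averages ⟹ pure gauge in `N(Q′)`, hypothesis `hFlat`) and `0 < a`, then `⟨A, Δ_a A⟩ = 0 ⟹ A = 0`, `Δ_a` is injective and invertible
   (`isUnit_det_gaugeFixed_of_flat`) — with NO uniformity; the uniform statement is §3's slice inequality.

HONEST FRAMING (T4-DAG p. 1).  [folklore] finite-dimensional linear algebra — OUR bookkeeping around the printed (3.21)/(3.25)/(3.26) for
abstract data; nothing printed is a hypothesis; the slice inequality is DISPLAYED, not proved (it is a discrete Gaffney/Maxwell-type gap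
for the pair (curl, divergence) on a lattice region, uniform in the spacing and the region — OPEN here; census `t4/T4-EST-NE2-D1-COERC.md`);
NOT the regularity of `R(U)` ((3.49)), NOT [B9] (3.23)–(3.27) as printed, NOT B0.  NE2 (U1a) NOT proved; spine 0/9 unchanged; NOT infinite
volume / mass gap / Clay / summit progress.  HONEST DEPENDENCY: continuum YM on T⁴ ⇐ BetaPertH ∧ nine spine estimates (0/9 proved);
BetaPertH ⇐ (D1) ∧ (D4) ∧ CAP+tail; G-an2-4 gates asym, D1 and NE2/3/4.  No `sorry`.
-/

noncomputable section

open scoped BigOperators ComplexConjugate Matrix Matrix.Norms.L2Operator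

namespace Summit.QuantumFields.BalabanUV.T4Continuum.RegionGaugeSlice

open Literature.MathematicalPhysics.QuantumFieldTheory.Balaban1983to89.B5Prop11Plancherel (opNorm_le_of_sq_le)
open Literature.MathematicalPhysics.QuantumFieldTheory.Balaban1983to89.B5Prop11Lower (nsq nsq_nonneg star_dotProduct_self
  norm_star_dotProduct_le nsq_mulVec_le)
open Literature.MathematicalPhysics.QuantumFieldTheory.Balaban1983to89.B5Action121 (star_mulVec_dotProduct
  dotProduct_mulVec_eq_star_conjTranspose_mulVec form_gram_rect)
open Summit.QuantumFields.BalabanUV.T4Continuum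
open Summit.QuantumFields.BalabanUV.T4Continuum.SubtypeCompression (Coercive isUnit_det_of_coercive opNorm_inv_le_of_coercive
  eq_zero_of_nsq_eq_zero)
open Summit.QuantumFields.BalabanUV.T4Continuum.ScalarBlockPoincare (nsq_add_le)
open Summit.QuantumFields.BalabanUV.T4Continuum.ScalarAveragedPropagator (re_star_dotProduct_le)
open Summit.QuantumFields.BalabanUV.T4Continuum.RegionGaugeProjection

variable {m v w u uv : Type*} [Fintype m] [DecidableEq m] [Fintype v] [Fintype u] [DecidableEq u]

/-! ## §1 The gauge-fixed operator and its quadratic form -/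

/-- **BAŁABAN's GAUGE-FIXED OPERATOR for abstract data**: `Δ_a = CᴴC + D·R·Dᴴ + a·QᴴQ` with `R = gaugeR G′ Q′` the projection (3.25)
— the three terms of «Δ_a = Δ + DRD* + Q*aQ» ((3.26); at `U = 1` [Balaban1984PropagatorsI] (1.69) «⟨A, ∂*∂A⟩ + ⟨A, ∂R∂*A⟩ + a⟨A, Q*QA⟩»).
[cite: Balaban1985BackgroundPropagators, (3.26) p.395 (shape)] [folklore] -/
def gaugeFixed [Fintype w] [Fintype uv] (Cu : Matrix w v ℂ) (Dg : Matrix v m ℂ) (G : Matrix m m ℂ) (Qs : Matrix u m ℂ)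
    (Qv : Matrix uv v ℂ) (a : ℝ) : Matrix v v ℂ :=
  Cuᴴ * Cu + Dg * gaugeR G Qs * Dgᴴ + (a : ℂ) • (Qvᴴ * Qv)

variable (Cu : Matrix w v ℂ) (Dg : Matrix v m ℂ) (Dp G : Matrix m m ℂ) (Qs : Matrix u m ℂ) (Qv : Matrix uv v ℂ) (Dg₁ : Matrix uv u ℂ)
  (a : ℝ)

omit [DecidableEq m] in
/-- the quadratic form of a Hermitian idempotent: `⟨x, Px⟩ = ‖Px‖²`. [folklore] -/
theorem form_proj {P : Matrix m m ℂ} (hH : P.IsHermitian) (hP : P * P = P) (x : m → ℂ) :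
    star x ⬝ᵥ (P *ᵥ x) = ((nsq (P *ᵥ x) : ℝ) : ℂ) := by
  rw [← star_dotProduct_self, star_mulVec_dotProduct, hH.eq, Matrix.mulVec_mulVec, hP]

/-- the quadratic form of a Gram operator: `⟨x, VᴴVx⟩ = ‖Vx‖²`. [folklore] -/
theorem form_gram {k : Type*} [Fintype k] (V : Matrix k v ℂ) (x : v → ℂ) :
    star x ⬝ᵥ ((Vᴴ * V) *ᵥ x) = ((nsq (V *ᵥ x) : ℝ) : ℂ) := by
  rw [form_gram_rect, star_dotProduct_self]

omit [Fintype v] in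
/-- `Δ_a` is Hermitian (real coupling, Hermitian `G′`). [folklore] -/
theorem gaugeFixed_isHermitian [Fintype w] [Fintype uv] (hG : G.IsHermitian) : (gaugeFixed Cu Dg G Qs Qv a).IsHermitian := by
  have hR := gaugeR_isHermitian G Qs hG
  unfold gaugeFixed Matrix.IsHermitian
  rw [Matrix.conjTranspose_add, Matrix.conjTranspose_add, Matrix.conjTranspose_smul, Matrix.conjTranspose_mul,
    Matrix.conjTranspose_mul, Matrix.conjTranspose_mul, Matrix.conjTranspose_mul, Matrix.conjTranspose_conjTranspose,
    Matrix.conjTranspose_conjTranspose, Matrix.conjTranspose_conjTranspose, hR.eq, Complex.star_def, Complex.conj_ofReal,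
    ← Matrix.mul_assoc]

/-- **THE QUADRATIC FORM**: `Re⟨A, Δ_a A⟩ = ‖CA‖² + ‖R·DᴴA‖² + a·‖QA‖²` (needs `R` Hermitian idempotent: `G′` Hermitian, `Q′G′²Q′ᴴ`
invertible). [cite: Balaban1984PropagatorsI, (1.69) p.29 (shape)] [folklore] -/
theorem form_gaugeFixed [Fintype w] [Fintype uv] (hG : G.IsHermitian) (hK : IsUnit (gramK G Qs).det) (A : v → ℂ) :
    (star A ⬝ᵥ (gaugeFixed Cu Dg G Qs Qv a *ᵥ A)).re
      = nsq (Cu *ᵥ A) + nsq (gaugeR G Qs *ᵥ (Dgᴴ *ᵥ A)) + a * nsq (Qv *ᵥ A) := by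
  have hmid : star A ⬝ᵥ ((Dg * gaugeR G Qs * Dgᴴ) *ᵥ A) = ((nsq (gaugeR G Qs *ᵥ (Dgᴴ *ᵥ A)) : ℝ) : ℂ) := by
    rw [← Matrix.mulVec_mulVec, ← Matrix.mulVec_mulVec, dotProduct_mulVec_eq_star_conjTranspose_mulVec,
      form_proj (gaugeR_isHermitian G Qs hG) (gaugeR_mul_gaugeR G Qs hK)]
  unfold gaugeFixed
  rw [Matrix.add_mulVec, Matrix.add_mulVec, Matrix.smul_mulVec, dotProduct_add, dotProduct_add, dotProduct_smul,
    form_gram, hmid, form_gram, smul_eq_mul, Complex.add_re, Complex.add_re, Complex.ofReal_re, Complex.ofReal_re,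
    ← Complex.ofReal_mul, Complex.ofReal_re]

/-! ## §2 The exact gauge decomposition along `R` -/

/-- **HYPOTHESIS STRUCTURE — the `U = 1` lattice identities behind (3.26), on abstract data** (a `structure … : Prop` on data; no fact is
asserted): `C·D = 0` (curl ∘ grad), `Q·D = D₁·Q′` («Q∂ = ∂₁Q′», [Balaban1984PropagatorsI] (1.20)/(1.55)), on `N(Q′)` the averaged scalar
operator is the Laplacian `DᴴD`, `G′ = (Δ′)⁻¹` Hermitian two-sided, and `Q′G′²Q′ᴴ` invertible («existence of R», p. 395).
[cite: Balaban1985BackgroundPropagators, (3.21)–(3.26) pp.394–395 (shapes)] [folklore] -/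
structure SliceData : Prop where
  /-- curl of a gradient vanishes -/
  curl_grad : Cu * Dg = 0
  /-- averaging intertwines the gradients: `Q∂ = ∂₁Q′` -/
  avg_grad : Qv * Dg = Dg₁ * Qs
  /-- on `N(Q′)` the scalar operator `Δ′` is `DᴴD` -/
  lap_of_ker : ∀ lam : m → ℂ, Qs *ᵥ lam = 0 → Dp *ᵥ lam = Dgᴴ *ᵥ (Dg *ᵥ lam)
  /-- `G′` is Hermitian -/
  herm : G.IsHermitian
  /-- `G′Δ′ = 1` -/
  G_mul : G * Dp = 1
  /-- `Δ′G′ = 1` -/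
  mul_G : Dp * G = 1
  /-- `Q′G′²Q′ᴴ` is invertible -/
  gram_unit : IsUnit (gramK G Qs).det

/-- the GAUGE PART `λ_A = G′·R·DᴴA` of a vector field (the `λ₀` of (3.22) for `f = DᴴA`: `Rf = Δ′λ₀`).
[cite: Balaban1985BackgroundPropagators, (3.22) p.394 (shape)] [folklore] -/
def gaugePart (A : v → ℂ) : m → ℂ := G *ᵥ (gaugeR G Qs *ᵥ (Dgᴴ *ᵥ A))

/-- the SLICE PART `A′ = A − D·λ_A`. [folklore] -/
def slicePart (A : v → ℂ) : v → ℂ := A - Dg *ᵥ gaugePart Dg G Qs A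

variable {Cu Dg Dp G Qs Qv Dg₁}

/-- `λ_A ∈ N(Q′)`: `Q′λ_A = 0`. [folklore] -/
theorem Qs_gaugePart (h : SliceData Cu Dg Dp G Qs Qv Dg₁) (A : v → ℂ) : Qs *ᵥ gaugePart Dg G Qs A = 0 :=
  Q_mulVec_G_mulVec_gaugeR G Qs h.gram_unit _

/-- `Δ′λ_A = R·DᴴA`. [folklore] -/
theorem Dp_gaugePart (h : SliceData Cu Dg Dp G Qs Qv Dg₁) (A : v → ℂ) :
    Dp *ᵥ gaugePart Dg G Qs A = gaugeR G Qs *ᵥ (Dgᴴ *ᵥ A) := by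
  rw [gaugePart, Matrix.mulVec_mulVec, h.mul_G, Matrix.one_mulVec]

/-- `λ_A = G′·Δ′λ_A`. [folklore] -/
theorem gaugePart_eq_G_Dp (h : SliceData Cu Dg Dp G Qs Qv Dg₁) (A : v → ℂ) :
    gaugePart Dg G Qs A = G *ᵥ (Dp *ᵥ gaugePart Dg G Qs A) := by
  rw [Matrix.mulVec_mulVec, h.G_mul, Matrix.one_mulVec]

/-- `DᴴDλ_A = R·DᴴA` (the gauge part's Laplacian is the `R`-component of the divergence). [folklore] -/
theorem DhD_gaugePart (h : SliceData Cu Dg Dp G Qs Qv Dg₁) (A : v → ℂ) :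
    Dgᴴ *ᵥ (Dg *ᵥ gaugePart Dg G Qs A) = gaugeR G Qs *ᵥ (Dgᴴ *ᵥ A) := by
  rw [← h.lap_of_ker _ (Qs_gaugePart h A), Dp_gaugePart h A]

/-- the divergence of the slice part is the `P`-component: `DᴴA′ = (1 − R)·DᴴA`. [folklore] -/
theorem Dh_slicePart (h : SliceData Cu Dg Dp G Qs Qv Dg₁) (A : v → ℂ) :
    Dgᴴ *ᵥ slicePart Dg G Qs A = Dgᴴ *ᵥ A - gaugeR G Qs *ᵥ (Dgᴴ *ᵥ A) := by
  rw [slicePart, Matrix.mulVec_sub, DhD_gaugePart h A]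

/-- **`A′` LIES ON BAŁABAN's SLICE**: `R·DᴴA′ = 0`. [cite: Balaban1985BackgroundPropagators, (3.21) p.394 (shape)] [folklore] -/
theorem gaugeR_Dh_slicePart (h : SliceData Cu Dg Dp G Qs Qv Dg₁) (A : v → ℂ) :
    gaugeR G Qs *ᵥ (Dgᴴ *ᵥ slicePart Dg G Qs A) = 0 := by
  have hRR : gaugeR G Qs *ᵥ (gaugeR G Qs *ᵥ (Dgᴴ *ᵥ A)) = gaugeR G Qs *ᵥ (Dgᴴ *ᵥ A) := by
    rw [Matrix.mulVec_mulVec, gaugeR_mul_gaugeR G Qs h.gram_unit]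
  rw [Dh_slicePart h A, Matrix.mulVec_sub, hRR, sub_self]

/-- `CA′ = CA` (the gauge part is curl-free). [folklore] -/
theorem Cu_slicePart (h : SliceData Cu Dg Dp G Qs Qv Dg₁) (A : v → ℂ) : Cu *ᵥ slicePart Dg G Qs A = Cu *ᵥ A := by
  rw [slicePart, Matrix.mulVec_sub, Matrix.mulVec_mulVec, h.curl_grad, Matrix.zero_mulVec, sub_zero]

/-- `QA′ = QA` (the gauge part has zero block averages: `QDλ = D₁Q′λ = 0`). [folklore] -/
theorem Qv_slicePart (h : SliceData Cu Dg Dp G Qs Qv Dg₁) (A : v → ℂ) : Qv *ᵥ slicePart Dg G Qs A = Qv *ᵥ A := by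
  rw [slicePart, Matrix.mulVec_sub, Matrix.mulVec_mulVec, h.avg_grad, ← Matrix.mulVec_mulVec, Qs_gaugePart h A,
    Matrix.mulVec_zero, sub_zero]

/-- `A = Dλ_A + A′`. [folklore] -/
theorem decomp (A : v → ℂ) : A = Dg *ᵥ gaugePart Dg G Qs A + slicePart Dg G Qs A := by
  rw [slicePart, add_sub_cancel]

/-- **THE FORM ALONG THE DECOMPOSITION**: `Re⟨A, Δ_a A⟩ = ‖CA′‖² + ‖Δ′λ_A‖² + a‖QA′‖²`. [folklore] -/
theorem form_gaugeFixed_decomp [Fintype w] [Fintype uv] (h : SliceData Cu Dg Dp G Qs Qv Dg₁) (A : v → ℂ) :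
    (star A ⬝ᵥ (gaugeFixed Cu Dg G Qs Qv a *ᵥ A)).re
      = nsq (Cu *ᵥ slicePart Dg G Qs A) + nsq (Dp *ᵥ gaugePart Dg G Qs A) + a * nsq (Qv *ᵥ slicePart Dg G Qs A) := by
  rw [form_gaugeFixed Cu Dg G Qs Qv a h.herm h.gram_unit, Cu_slicePart h, Qv_slicePart h, Dp_gaugePart h]

/-- `Re⟨Gy, y⟩ ≤ ‖G‖·‖y‖²`. [folklore] -/
theorem re_form_le_opNorm (X : Matrix m m ℂ) (y : m → ℂ) : (star (X *ᵥ y) ⬝ᵥ y).re ≤ ‖X‖ * nsq y := by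
  have h1 := re_star_dotProduct_le (X *ᵥ y) y
  have h2 : Real.sqrt (nsq (X *ᵥ y)) ≤ ‖X‖ * Real.sqrt (nsq y) := by
    rw [← Real.sqrt_sq (norm_nonneg X), ← Real.sqrt_mul (sq_nonneg _)]
    exact Real.sqrt_le_sqrt (nsq_mulVec_le X y)
  calc (star (X *ᵥ y) ⬝ᵥ y).re ≤ Real.sqrt (nsq (X *ᵥ y)) * Real.sqrt (nsq y) := h1
    _ ≤ ‖X‖ * Real.sqrt (nsq y) * Real.sqrt (nsq y) := by gcongr
    _ = ‖X‖ * nsq y := by rw [mul_assoc, Real.mul_self_sqrt (nsq_nonneg _)]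

/-- **THE GAUGE PART IS PAID BY THE MIDDLE TERM**: `‖Dλ_A‖² = Re⟨λ_A, Δ′λ_A⟩ ≤ ‖G′‖·‖Δ′λ_A‖²`. [folklore] -/
theorem nsq_D_gaugePart_le (h : SliceData Cu Dg Dp G Qs Qv Dg₁) (A : v → ℂ) :
    nsq (Dg *ᵥ gaugePart Dg G Qs A) ≤ ‖G‖ * nsq (Dp *ᵥ gaugePart Dg G Qs A) := by
  set lam := gaugePart Dg G Qs A with hlam
  have e1 : ((nsq (Dg *ᵥ lam) : ℝ) : ℂ) = star lam ⬝ᵥ (Dp *ᵥ lam) := by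
    rw [← star_dotProduct_self, star_mulVec_dotProduct, h.lap_of_ker _ (Qs_gaugePart h A)]
  have e2 : star lam ⬝ᵥ (Dp *ᵥ lam) = star (G *ᵥ (Dp *ᵥ lam)) ⬝ᵥ (Dp *ᵥ lam) := by
    rw [← gaugePart_eq_G_Dp h A]
  have e3 : nsq (Dg *ᵥ lam) = (star (G *ᵥ (Dp *ᵥ lam)) ⬝ᵥ (Dp *ᵥ lam)).re := by
    rw [← e2, ← e1, Complex.ofReal_re]
  rw [e3]
  exact re_form_le_opNorm G _

/-- `‖A‖² ≤ 2‖A′‖² + 2‖G′‖·‖Δ′λ_A‖²`. [folklore] -/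
theorem nsq_le_decomp (h : SliceData Cu Dg Dp G Qs Qv Dg₁) (A : v → ℂ) :
    nsq A ≤ 2 * nsq (slicePart Dg G Qs A) + 2 * (‖G‖ * nsq (Dp *ᵥ gaugePart Dg G Qs A)) := by
  have h1 : nsq A ≤ 2 * nsq (slicePart Dg G Qs A) + 2 * nsq (Dg *ᵥ gaugePart Dg G Qs A) := by
    have e : A = slicePart Dg G Qs A + Dg *ᵥ gaugePart Dg G Qs A := by rw [slicePart, sub_add_cancel]
    conv_lhs => rw [e]
    exact nsq_add_le _ _
  have h2 := nsq_D_gaugePart_le h A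
  linarith

/-! ## §3 The reduction: coercivity of `Δ_a` ⟺ coercivity of the gauge-invariant form on the slice -/

/-- **COERCIVITY OF THE GAUGE-INVARIANT FORM ON BAŁABAN's SLICE** (parametric shape predicate, like `Coercive`): every `A′` with
`R·DᴴA′ = 0` obeys `c‖A′‖² ≤ ‖CA′‖² + a‖QA′‖²`.  THIS is the analytic content of O12-c (iii); displayed, not proved. [folklore] -/
def SliceCoercive [Fintype w] [Fintype uv] (Cu : Matrix w v ℂ) (Dg : Matrix v m ℂ) (G : Matrix m m ℂ) (Qs : Matrix u m ℂ) (Qv : Matrix uv v ℂ) (a c : ℝ) : Prop :=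
  ∀ A' : v → ℂ, gaugeR G Qs *ᵥ (Dgᴴ *ᵥ A') = 0 → c * nsq A' ≤ nsq (Cu *ᵥ A') + a * nsq (Qv *ᵥ A')

/-- **THE REDUCTION (⇐)**: slice coercivity with constant `c > 0` and `‖G′‖ ≤ g` (`g > 0`) ⟹ `Δ_a` is coercive with
`γ = min(c/2, 1/(2g))`. [cite: Balaban1985BackgroundPropagators, (3.27) p.395 (shape: existence of G)] [folklore] -/
theorem coercive_gaugeFixed_of_slice [Fintype w] [Fintype uv] (h : SliceData Cu Dg Dp G Qs Qv Dg₁) {c g : ℝ} (hc : 0 < c)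
    (hS : SliceCoercive Cu Dg G Qs Qv a c) (hg : ‖G‖ ≤ g) (hg0 : 0 < g) :
    Coercive (gaugeFixed Cu Dg G Qs Qv a) (min (c / 2) (1 / (2 * g))) := by
  intro A
  set γ := min (c / 2) (1 / (2 * g)) with hγ
  have hγc : 2 * γ ≤ c := by
    have := min_le_left (c / 2) (1 / (2 * g)); linarith
  have hγg : 2 * γ * g ≤ 1 := by
    have h1 := min_le_right (c / 2) (1 / (2 * g))
    have h2 : γ * (2 * g) ≤ 1 / (2 * g) * (2 * g) := mul_le_mul_of_nonneg_right h1 (by positivity)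
    rw [div_mul_cancel₀ _ (by positivity)] at h2
    linarith
  have hγ0 : 0 ≤ γ := le_min (by linarith) (by positivity)
  have hA := nsq_le_decomp h A
  have hS' := hS (slicePart Dg G Qs A) (gaugeR_Dh_slicePart h A)
  rw [form_gaugeFixed_decomp a h A]
  set x := nsq (slicePart Dg G Qs A)
  set y := nsq (Dp *ᵥ gaugePart Dg G Qs A)
  have h1 : γ * nsq A ≤ 2 * γ * x + 2 * γ * (‖G‖ * y) := by
    calc γ * nsq A ≤ γ * (2 * x + 2 * (‖G‖ * y)) := mul_le_mul_of_nonneg_left hA hγ0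
      _ = 2 * γ * x + 2 * γ * (‖G‖ * y) := by ring
  have h2 : 2 * γ * x ≤ c * x := mul_le_mul_of_nonneg_right hγc (nsq_nonneg _)
  have h3 : 2 * γ * (‖G‖ * y) ≤ y := by
    have h4 : 2 * γ * ‖G‖ ≤ 1 := le_trans (mul_le_mul_of_nonneg_left hg (by positivity)) hγg
    calc 2 * γ * (‖G‖ * y) = (2 * γ * ‖G‖) * y := by ring
      _ ≤ 1 * y := mul_le_mul_of_nonneg_right h4 (nsq_nonneg _)
      _ = y := one_mul _
  linarith

/-- the constant is positive. [folklore] -/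
theorem gamma_pos {c g : ℝ} (hc : 0 < c) (hg0 : 0 < g) : 0 < min (c / 2) (1 / (2 * g)) :=
  lt_min (by positivity) (by positivity)

/-- **«G EXISTS»**: under slice coercivity `Δ_a` is invertible … [cite: Balaban1985BackgroundPropagators, (3.27) p.395 (shape)] [folklore] -/
theorem isUnit_det_gaugeFixed_of_slice [Fintype w] [Fintype uv] [DecidableEq v] (h : SliceData Cu Dg Dp G Qs Qv Dg₁) {c g : ℝ} (hc : 0 < c)
    (hS : SliceCoercive Cu Dg G Qs Qv a c) (hg : ‖G‖ ≤ g) (hg0 : 0 < g) : IsUnit (gaugeFixed Cu Dg G Qs Qv a).det :=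
  isUnit_det_of_coercive (gamma_pos hc hg0) (coercive_gaugeFixed_of_slice a h hc hS hg hg0)

/-- **… WITH `‖G‖ = ‖Δ_a⁻¹‖ ≤ γ⁻¹ = max(2/c, 2g)`**, uniform in everything the two constants `c`, `g` are uniform in.
[cite: Balaban1985BackgroundPropagators, (3.27) p.395 (shape)] [folklore] -/
theorem opNorm_inv_gaugeFixed_le_of_slice [Fintype w] [Fintype uv] [DecidableEq v] (h : SliceData Cu Dg Dp G Qs Qv Dg₁) {c g : ℝ} (hc : 0 < c)
    (hS : SliceCoercive Cu Dg G Qs Qv a c) (hg : ‖G‖ ≤ g) (hg0 : 0 < g) :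
    ‖(gaugeFixed Cu Dg G Qs Qv a)⁻¹‖ ≤ (min (c / 2) (1 / (2 * g)))⁻¹ :=
  opNorm_inv_le_of_coercive (gamma_pos hc hg0) (coercive_gaugeFixed_of_slice a h hc hS hg hg0)

/-- **THE REDUCTION (⇒)**: if `Δ_a ≥ γ` then the gauge-invariant form is `γ`-coercive on the slice (on the slice the middle term of
`Δ_a` vanishes).  So slice coercivity is NECESSARY as well as sufficient. [folklore] -/
theorem sliceCoercive_of_coercive [Fintype w] [Fintype uv] (hG : G.IsHermitian) (hK : IsUnit (gramK G Qs).det) {γ : ℝ}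
    (hco : Coercive (gaugeFixed Cu Dg G Qs Qv a) γ) : SliceCoercive Cu Dg G Qs Qv a γ := by
  intro A' hA'
  have h := hco A'
  rw [form_gaugeFixed Cu Dg G Qs Qv a hG hK, hA'] at h
  have h0 : nsq (0 : m → ℂ) = 0 := by simp [nsq]
  rw [h0] at h
  linarith

/-! ## §4 Positivity from the flatness lemma (qualitative, no uniformity) -/

/-- the form is a sum of squares, hence nonnegative (for `0 ≤ a`). [folklore] -/
theorem form_gaugeFixed_nonneg [Fintype w] [Fintype uv] (hG : G.IsHermitian) (hK : IsUnit (gramK G Qs).det) (ha : 0 ≤ a) (A : v → ℂ) :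
    0 ≤ (star A ⬝ᵥ (gaugeFixed Cu Dg G Qs Qv a *ᵥ A)).re := by
  rw [form_gaugeFixed Cu Dg G Qs Qv a hG hK]
  have := nsq_nonneg (Cu *ᵥ A); have := nsq_nonneg (gaugeR G Qs *ᵥ (Dgᴴ *ᵥ A)); have := nsq_nonneg (Qv *ᵥ A)
  positivity

/-- **POSITIVITY OF `Δ_a` FROM THE FLATNESS LEMMA**: if every curl-free field with zero block averages is a pure gauge `Dλ` with
`λ ∈ N(Q′)` (`hFlat` — on a lattice region: the Poincaré lemma + «Q∂ = ∂₁Q′»), and `0 < a`, then `⟨A, Δ_a A⟩ = 0 ⟹ A = 0`.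
(The qualitative content of «positivity of Δ′_a … hence the existence of the operator R» transferred to the VECTOR operator (3.26);
the constant is §3's business.) [cite: Balaban1985BackgroundPropagators, p.395 (shape)] [folklore] -/
theorem eq_zero_of_form_eq_zero [Fintype w] [Fintype uv] (h : SliceData Cu Dg Dp G Qs Qv Dg₁) (ha : 0 < a)
    (hFlat : ∀ A : v → ℂ, Cu *ᵥ A = 0 → Qv *ᵥ A = 0 → ∃ lam : m → ℂ, Qs *ᵥ lam = 0 ∧ A = Dg *ᵥ lam)
    (A : v → ℂ) (h0 : (star A ⬝ᵥ (gaugeFixed Cu Dg G Qs Qv a *ᵥ A)).re = 0) : A = 0 := by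
  rw [form_gaugeFixed_decomp a h A] at h0
  have h1 := nsq_nonneg (Cu *ᵥ slicePart Dg G Qs A)
  have h2 := nsq_nonneg (Dp *ᵥ gaugePart Dg G Qs A)
  have h3 := nsq_nonneg (Qv *ᵥ slicePart Dg G Qs A)
  have h3' : 0 ≤ a * nsq (Qv *ᵥ slicePart Dg G Qs A) := by positivity
  have hC : nsq (Cu *ᵥ slicePart Dg G Qs A) = 0 := by linarith
  have hD : nsq (Dp *ᵥ gaugePart Dg G Qs A) = 0 := by linarith
  have hQ : nsq (Qv *ᵥ slicePart Dg G Qs A) = 0 := by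
    have : a * nsq (Qv *ᵥ slicePart Dg G Qs A) = 0 := by linarith
    rcases mul_eq_zero.mp this with h | h
    · exact absurd h (ne_of_gt ha)
    · exact h
  -- the gauge part vanishes
  have hlam : gaugePart Dg G Qs A = 0 := by
    rw [gaugePart_eq_G_Dp h A, eq_zero_of_nsq_eq_zero hD, Matrix.mulVec_zero]
  have hA' : slicePart Dg G Qs A = A := by rw [slicePart, hlam, Matrix.mulVec_zero, sub_zero]
  -- `A` is flat with zero averages, hence pure gauge in `N(Q′)`
  have hCu : Cu *ᵥ A = 0 := by rw [← hA']; exact eq_zero_of_nsq_eq_zero hC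
  have hQv : Qv *ᵥ A = 0 := by rw [← hA']; exact eq_zero_of_nsq_eq_zero hQ
  obtain ⟨mu, hmu, hAmu⟩ := hFlat A hCu hQv
  -- then `R·DᴴA = Δ′μ`, i.e. `Δ′λ_A = Δ′μ = 0`, so `μ = 0`
  have hR : gaugeR G Qs *ᵥ (Dgᴴ *ᵥ A) = Dp *ᵥ mu := by
    rw [hAmu, ← h.lap_of_ker mu hmu]
    exact gaugeR_mulVec_D_mulVec G Qs h.G_mul mu hmu
  have hmu0 : mu = 0 := by
    have e : Dp *ᵥ mu = 0 := by rw [← hR, ← Dp_gaugePart h A, hlam, Matrix.mulVec_zero]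
    calc mu = G *ᵥ (Dp *ᵥ mu) := by rw [Matrix.mulVec_mulVec, h.G_mul, Matrix.one_mulVec]
      _ = 0 := by rw [e, Matrix.mulVec_zero]
  rw [hAmu, hmu0, Matrix.mulVec_zero]

/-- hence `Δ_a` is injective … [folklore] -/
theorem mulVec_injective_of_flat [Fintype w] [Fintype uv] (h : SliceData Cu Dg Dp G Qs Qv Dg₁) (ha : 0 < a)
    (hFlat : ∀ A : v → ℂ, Cu *ᵥ A = 0 → Qv *ᵥ A = 0 → ∃ lam : m → ℂ, Qs *ᵥ lam = 0 ∧ A = Dg *ᵥ lam) :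
    Function.Injective (gaugeFixed Cu Dg G Qs Qv a).mulVec := by
  intro A B hAB
  have hsub : gaugeFixed Cu Dg G Qs Qv a *ᵥ (A - B) = 0 := by
    rw [Matrix.mulVec_sub]; exact sub_eq_zero.mpr hAB
  have h0 : (star (A - B) ⬝ᵥ (gaugeFixed Cu Dg G Qs Qv a *ᵥ (A - B))).re = 0 := by
    rw [hsub, dotProduct_zero, Complex.zero_re]
  exact sub_eq_zero.mp (eq_zero_of_form_eq_zero a h ha hFlat (A - B) h0)

/-- **… AND INVERTIBLE** — «the existence of the operator G = (Δ_a↾Ω₀)⁻¹» from the flatness lemma alone (finite dimension; NO bound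
on `‖G‖` — that is §3). [cite: Balaban1985BackgroundPropagators, (3.27) p.395 (shape)] [folklore] -/
theorem isUnit_det_gaugeFixed_of_flat [Fintype w] [Fintype uv] [DecidableEq v] (h : SliceData Cu Dg Dp G Qs Qv Dg₁) (ha : 0 < a)
    (hFlat : ∀ A : v → ℂ, Cu *ᵥ A = 0 → Qv *ᵥ A = 0 → ∃ lam : m → ℂ, Qs *ᵥ lam = 0 ∧ A = Dg *ᵥ lam) :
    IsUnit (gaugeFixed Cu Dg G Qs Qv a).det :=
  (Matrix.isUnit_iff_isUnit_det _).mp (Matrix.mulVec_injective_iff_isUnit.mp (mulVec_injective_of_flat a h ha hFlat))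

end Summit.QuantumFields.BalabanUV.T4Continuum.RegionGaugeSlice

end
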